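import Literature.AlgebraicTopology.Homotopy.WangDerivation
import Literature.Topology.FourManifolds.ComplexProjectiveSpaceCohomologyRing
import HarnessLib

/-!
# The Wang derivation on cup powers: `D(xʲ⁺¹) = (j+1) xʲ ⌣ D x` over `S³`

G. W. Whitehead, *Elements of Homotopy Theory* (1978), Ch. VII §7, Thm. 7.14 (3) (the Wang map
`θ` is a derivation) and its classical consequence (J.-P. Serre, *Homologie singulière des espaces
fibrés*, Ann. of Math. 54 (1951), Ch. III §6–7, proof of Prop. 9 for `S³⟨3⟩`; Hatcher,
*Spectral Sequences* (2004), Example 1.17 p. 25: "`d(xⁿ) = n xⁿ⁻¹ dx`"): for a fibration over `S³`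
(`k = 1`, the derivation `D` of `WangSequence.lean` lowers degrees by `2`) and a class
`x ∈ H²(F; R)`, by induction from the Leibniz rule `Wang.D_cupProduct` (`WangDerivation.lean`):

* `Wang.D_cupPowL` — **`D (xʲ⁺¹) = (j + 1) • (xʲ ⌣ D x)`** in `H²ʲ(F; R)`, for the left cup powers
  `cupPowL x j` of `ComplexProjectiveSpaceCohomologyRing.lean`, any commutative ring `R`.

Index discipline: `Wang.D i` has domain `H^{i+(k+1)}`; the induction uses `D_cupProduct` with the
power FIRST and `x` second (result degree `(2j + 2) + 0`, definitionally `2j + 2`), after swapping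
`x ⌣ xʲ⁺¹ = xʲ⁺¹ ⌣ x` by graded commutativity (even degrees). Everything is proved; no definitions.

## References

* G. W. Whitehead, *Elements of Homotopy Theory*, GTM 61 (1978), Ch. VII §7, Thm. 7.14 (3).
  [Whitehead1978]
* J.-P. Serre, *Homologie singulière des espaces fibrés*, Ann. of Math. 54 (1951), Ch. III §6–7.
  [Serre1951]
-/

noncomputable section

open Set Function Metric unitInterval CategoryTheory
open scoped Topology unitInterval
open Literature.AlgebraicTopology.SingularHomology Literature.Topology.FourManifolds

namespace Literature.AlgebraicTopology.Homotopy

namespace Wang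

variable (R : Type) [CommRing R] {E : Type} [TopologicalSpace E] (P : Poles 1)
  {p : E → (Metric.sphere (0 : EuclideanSpace ℝ (Fin (1 + 2 + 1))) 1)}

/-- `xʲ ⌣ x = x ⌣ xʲ = xʲ⁺¹` (graded commutativity in even degrees). [folklore] -/
theorem cupPowL_cupProduct_self (x : singularCohomology R R (Fib P p) 2) (j : ℕ) :
    cupProduct (show 2 * j + 2 = 2 * (j + 1) by ring) (cupPowL x j) x = cupPowL x (j + 1) := by
  rw [cupPowL_succ, cupProduct_gradedComm_holds R (Fib P p) (show 2 * j + 2 = 2 * (j + 1) by ring)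
    (show 2 + 2 * j = 2 * (j + 1) by ring) (cupPowL x j) x]
  have h : ((-1 : R) ^ (2 * j * 2)) = 1 := by
    rw [show 2 * j * 2 = 2 * (j * 2) by ring, pow_mul, neg_one_sq, one_pow]
  rw [h, one_smul]

/-- `(xʲ ⌣ u) ⌣ x = xʲ⁺¹ ⌣ u` for `u` of degree `0`. [folklore] -/
theorem cupProduct_cupPowL_zero_self (x : singularCohomology R R (Fib P p) 2)
    (u : singularCohomology R R (Fib P p) 0) (j : ℕ) :
    cupProduct (show 2 * j + 2 = 2 * (j + 1) by ring) (cupProduct (rfl : 2 * j + 0 = 2 * j) (cupPowL x j) u) x =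
      cupProduct rfl (cupPowL x (j + 1)) u := by
  -- `(xʲ ⌣ u) ⌣ x = xʲ ⌣ (u ⌣ x) = xʲ ⌣ (x ⌣ u) = (xʲ ⌣ x) ⌣ u = xʲ⁺¹ ⌣ u`
  rw [cupProduct_assoc (rfl : 2 * j + 0 = 2 * j) (Nat.zero_add 2) (show 2 * j + 2 = 2 * (j + 1) by ring)
    (show 2 * j + 2 = 2 * (j + 1) by ring) (cupPowL x j) u x]
  rw [cupProduct_gradedComm_holds R (Fib P p) (Nat.zero_add 2) (Nat.add_zero 2) u x, zero_mul, pow_zero, one_smul]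
  rw [← cupProduct_assoc (show 2 * j + 2 = 2 * (j + 1) by ring) (Nat.add_zero 2)
    (rfl : 2 * (j + 1) + 0 = 2 * (j + 1)) (show 2 * j + 2 = 2 * (j + 1) by ring) (cupPowL x j) x u]
  rw [cupPowL_cupProduct_self]

/-- **`D (xʲ⁺¹) = (j + 1) • (xʲ ⌣ D x)`** for a Hurewicz/Serre fibration over `S³` and `x ∈ H²(F; R)`
(Whitehead VII.7.14 (3) iterated; Serre 1951, III §7; Hatcher SSAT Ex. 1.17: "`d(xⁿ) = n xⁿ⁻¹ dx`").
Here `D (2j) : H^{2j+2}(F) → H^{2j}(F)` is `Wang.D` with `k = 1`. [cite: Whitehead1978, Ch. VII §7, Thm. 7.14 (3)]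
[cite: Serre1951, Ch. III §7] -/
theorem D_cupPowL (hp : IsHurewiczFibration.{0, 0, 0} p) (hpS : IsSerreFibration p)
    (x : singularCohomology R R (Fib P p) 2) :
    ∀ j : ℕ, D R P hp hpS (2 * j) (cupPowL x (j + 1)) =
      ((j + 1 : ℕ) : R) • cupProduct (rfl : 2 * j + 0 = 2 * j) (cupPowL x j) (D R P hp hpS 0 x)
  | 0 => by
    rw [Nat.cast_one, one_smul, cupPowL_zero]
    change D R P hp hpS 0 (cupPowL x 1) = _
    rw [cupPowL_one, one_cupProduct]
  | j + 1 => by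
    have ih := D_cupPowL hp hpS x j
    -- `xʲ⁺² = xʲ⁺¹ ⌣ x`
    have hswap : cupPowL x (j + 1 + 1) =
        cupProduct (show (2 * j + (1 + 1)) + (0 + (1 + 1)) = (2 * j + (1 + 1) + 0) + (1 + 1) by omega)
          (cupPowL x (j + 1)) x := by
      rw [← cupPowL_cupProduct_self R P x (j + 1)]
    change D R P hp hpS (2 * j + (1 + 1) + 0) (cupPowL x (j + 1 + 1)) = _
    rw [hswap, D_cupProduct R P hp hpS (i := 2 * j) (j := 0) (cupPowL x (j + 1)) x]
    -- the sign is `+1`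
    have hsign : ((-1 : R) ^ ((2 * j + (1 + 1)) * (1 + 1))) = 1 := by
      rw [show (2 * j + (1 + 1)) * (1 + 1) = 2 * ((j + 1) * 2) by ring, pow_mul, neg_one_sq, one_pow]
    rw [hsign, one_smul]
    -- insert the induction hypothesis
    change cupProduct _ (D R P hp hpS (2 * j) (cupPowL x (j + 1))) x + cupProduct rfl (cupPowL x (j + 1)) (D R P hp hpS 0 x) = _
    rw [ih, map_smul, LinearMap.smul_apply]
    change ((j + 1 : ℕ) : R) • cupProduct (show 2 * j + 2 = 2 * (j + 1) by ring)
        (cupProduct (rfl : 2 * j + 0 = 2 * j) (cupPowL x j) (D R P hp hpS 0 x)) x +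
      cupProduct rfl (cupPowL x (j + 1)) (D R P hp hpS 0 x) = _
    rw [cupProduct_cupPowL_zero_self, show ((j + 1 + 1 : ℕ) : R) = ((j + 1 : ℕ) : R) + 1 by push_cast; ring,
      add_smul, one_smul]

end Wang

end Literature.AlgebraicTopology.Homotopy

end
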